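import Summits.QuantumFields.YangMills.Theorems.BalabanLadderInfVolRPSeries
import Literature.MathematicalPhysics.QuantumFieldTheory.SchwingerLimitInheritance
import HarnessLib

/-!
# Infinite-volume OS data, VI: E3 (symmetry) of the plane-string series is exact and passes to the limit

R136 (i) «infinite-volume ∕ continuum-from-UV» programme (director-ym), prover seat `ym-infvol-p3`, pre-birth
support filed `--supports` the spine leg `UV` (stmt-QuantumFields-19351) of `route-QuantumFields-BalabanLadder`.
HONEST FRAMING: conditional material for the EXISTENCE half (OS0–OS3 of a continuum limit); not a mass gap, not
Clay; NOTHING is asserted about Yang–Mills — finite-sum ∕ series algebra for an arbitrary measure on `LGConfig 4 G`.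

«OS axioms through the limit», the symmetry axiom E3 (OS 1973 §3): the orientation-summed plane-string series
`Λ n F = Σ_{Q valid} Σ'ₓ stateMomentStr G r μ n Q x · F(a (x + o∘Q))` of ANY state `μ` (p1's weights, p2's series) is
EXACTLY invariant under permutations of the arguments, `Λ n (F^π) = Λ n F` (the weights are symmetric under the joint
permutation of orientations and sites, `stateMomentStr_comp_perm`; reindex `Q ↦ Q∘π`, `x ↦ x∘π`), so every pointwise
limit on `⁰𝒮` inherits E3:

* `stateMomentStr_comp_perm`, `series_permTest` (exact lattice E3, any measure, any spacing, any offsets);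
* `isSymmetric_of_tendsto_of_invariant` — abstract inheritance for raw functionals (limits are unique; `⁰𝒮` is stable
  under `permTest`, Literature `IsOffDiagonal.permTest`);
* **`isSymmetric_of_stateMomentStr_series_tendsto`** — if the orientation-summed series of states `μ k` at spacings
  `a k` converge on `⁰𝒮` to a one-field family `S₁` (all arities), then `S₁.toLabelled.IsSymmetric`.

References: K. Osterwalder, R. Schrader, CMP 31 (1973) §3 (E3); CMP 42 (1975) §4.
-/

noncomputable section

open scoped SchwartzMap BigOperators
open MeasureTheory Filter Topology
open Literature.MathematicalPhysics.QuantumFieldTheory Literature.MathematicalPhysics.QuantumLattice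
open Literature.MathematicalPhysics.AQFT
open Literature.Probability.LatticeModels (box Site)
open Summit.QuantumFields.YangMills.Cruxes.OSLegsFromFemtoAndGap.DlrCollarTransfer (plane)
open Summit.QuantumFields.YangMills.Theorems.OSLegsFromFemtoAndGap (sum_piFinset_comp_perm)
open Summit.QuantumFields.YangMills.Theorems.InfiniteVolume (stateMomentStr)

namespace Summit.QuantumFields.YangMills.Theorems.InfVolRP

variable {G : Type} [Group G] [TopologicalSpace G] [IsTopologicalGroup G] [CompactSpace G]
  [MeasurableSpace G] [BorelSpace G]

/-! ### Exact lattice E3 -/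

omit [IsTopologicalGroup G] [CompactSpace G] [BorelSpace G] in
/-- **p1's centred moments are symmetric** under the joint permutation of orientations and sites. -/
theorem stateMomentStr_comp_perm (r : LatticeRep G) (μ : Measure (LGConfig 4 G)) {n : ℕ}
    (q : Fin n → Fin 4 × Fin 4) (x : Fin n → Site 4) (σ : Equiv.Perm (Fin n)) :
    stateMomentStr G r μ n (q ∘ σ) (x ∘ σ) = stateMomentStr G r μ n q x := by
  have h1 : stateMomentStr G r μ n (q ∘ σ) (x ∘ σ) =
      strWeight r μ (q ∘ σ) ((fun i => ∫ V, plane G r (q i) (x i) V ∂μ) ∘ σ) (x ∘ σ) := rfl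
  have h2 : stateMomentStr G r μ n q x = strWeight r μ q (fun i => ∫ V, plane G r (q i) (x i) V ∂μ) x := rfl
  rw [h1, h2, strWeight_comp_perm]

omit [IsTopologicalGroup G] [CompactSpace G] [BorelSpace G] in
/-- **Exact E3 of the orientation-summed plane-string series of a state**: `Λ n (F^π) = Λ n F` for every
permutation `π`, every measure `μ`, every spacing and every offset map. -/
theorem series_permTest (r : LatticeRep G) (μ : Measure (LGConfig 4 G)) (a : ℝ)
    (o : Fin 4 × Fin 4 → EuclideanSpace ℝ (Fin 4)) {n : ℕ} (π : Equiv.Perm (Fin n))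
    (F : 𝓢((Fin n → EuclideanSpace ℝ (Fin 4)), ℂ)) :
    ∑ Q ∈ Fintype.piFinset (fun _ : Fin n => Finset.univ.filter fun pl : Fin 4 × Fin 4 => pl.1 < pl.2),
        ∑' x : Fin n → Site 4,
          ((stateMomentStr G r μ n Q x : ℝ) : ℂ) * permTest π F (fun l => a • (siteToE (x l) + o (Q l))) =
      ∑ Q ∈ Fintype.piFinset (fun _ : Fin n => Finset.univ.filter fun pl : Fin 4 × Fin 4 => pl.1 < pl.2),
        ∑' x : Fin n → Site 4,
          ((stateMomentStr G r μ n Q x : ℝ) : ℂ) * F (fun l => a • (siteToE (x l) + o (Q l))) := by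
  classical
  set g : (Fin n → Fin 4 × Fin 4) → ℂ := fun Q => ∑' x : Fin n → Site 4,
    ((stateMomentStr G r μ n Q x : ℝ) : ℂ) * F (fun l => a • (siteToE (x l) + o (Q l))) with hg
  -- the sites: `x ↦ x ∘ π` is a bijection of `(ℤ⁴)ⁿ`
  set e : (Fin n → Site 4) ≃ (Fin n → Site 4) := Equiv.arrowCongr π.symm (Equiv.refl (Site 4)) with he
  have hex : ∀ x : Fin n → Site 4, e x = x ∘ π := fun x => by
    funext l
    simp [he, Equiv.arrowCongr_apply]
  have hQ : ∀ Q : Fin n → Fin 4 × Fin 4,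
      ∑' x : Fin n → Site 4, ((stateMomentStr G r μ n Q x : ℝ) : ℂ) *
          permTest π F (fun l => a • (siteToE (x l) + o (Q l))) = g (Q ∘ π) := by
    intro Q
    simp only [hg]
    conv_rhs => rw [← Equiv.tsum_eq e]
    refine tsum_congr fun x => ?_
    rw [hex, stateMomentStr_comp_perm, permTest_apply]
    rfl
  simp_rw [hQ]
  -- the orientations: `Q ↦ Q ∘ π` is a bijection of the valid strings
  exact sum_piFinset_comp_perm _ π g

/-! ### Inheritance of E3 along pointwise limits on `⁰𝒮` -/

/-- **E3 of a limit from exact invariance of the approximants** (raw functionals): if `Λ k n F → S₁ n F` for every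
off-diagonal `F` and `Λ k n (F^π) = Λ k n F` for all `k`, then `S₁.toLabelled.IsSymmetric`. -/
theorem isSymmetric_of_tendsto_of_invariant (S₁ : SchwingerFamily (EuclideanSpace ℝ (Fin 4)))
    (Λ : ℕ → (n : ℕ) → 𝓢((Fin n → EuclideanSpace ℝ (Fin 4)), ℂ) → ℂ)
    (hlim : ∀ (n : ℕ) (F : 𝓢((Fin n → EuclideanSpace ℝ (Fin 4)), ℂ)), IsOffDiagonal F →
      Tendsto (fun k => Λ k n F) atTop (𝓝 (S₁ n F)))
    (hinv : ∀ (k n : ℕ) (π : Equiv.Perm (Fin n)) (F : 𝓢((Fin n → EuclideanSpace ℝ (Fin 4)), ℂ)),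
      Λ k n (permTest π F) = Λ k n F) :
    S₁.toLabelled.IsSymmetric := by
  intro n k π F hF
  simp only [SchwingerFamily.toLabelled_apply]
  refine tendsto_nhds_unique (hlim n (permTest π F) (hF.permTest π)) ?_
  exact (hlim n F hF).congr fun j => (hinv j n π F).symm

omit [IsTopologicalGroup G] [CompactSpace G] [BorelSpace G] in
/-- **E3 of the continuum limit of the orientation-summed plane-string series.** For any states `μ k`, spacings
`a k` and offsets `o`, if `Σ_{Q valid} Σ'ₓ stateMomentStr G r (μ k) n Q x · F(a k (x + o∘Q)) → S₁ n F` for every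
off-diagonal `F`, then `S₁` is symmetric (E3). -/
theorem isSymmetric_of_stateMomentStr_series_tendsto (r : LatticeRep G) (μ : ℕ → Measure (LGConfig 4 G))
    (a : ℕ → ℝ) (o : Fin 4 × Fin 4 → EuclideanSpace ℝ (Fin 4)) (S₁ : SchwingerFamily (EuclideanSpace ℝ (Fin 4)))
    (hlim : ∀ (n : ℕ) (F : 𝓢((Fin n → EuclideanSpace ℝ (Fin 4)), ℂ)), IsOffDiagonal F →
      Tendsto (fun k =>
        ∑ Q ∈ Fintype.piFinset (fun _ : Fin n => Finset.univ.filter fun pl : Fin 4 × Fin 4 => pl.1 < pl.2),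
          ∑' x : Fin n → Site 4,
            ((stateMomentStr G r (μ k) n Q x : ℝ) : ℂ) * F (fun l => a k • (siteToE (x l) + o (Q l)))) atTop
        (𝓝 (S₁ n F))) :
    S₁.toLabelled.IsSymmetric :=
  isSymmetric_of_tendsto_of_invariant S₁ _ hlim fun k _ π F => series_permTest r (μ k) (a k) o π F

end Summit.QuantumFields.YangMills.Theorems.InfVolRP

end
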